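import Summits.QuantumFields.BalabanUV.T4Continuum.Support.DirichletCutoutBudgetScale
import Summits.QuantumFields.BalabanUV.T4Continuum.Support.DirichletBlockRegDefect
import Summits.QuantumFields.BalabanUV.T4Continuum.Support.DirichletBlockRegRateLemmas
import Summits.QuantumFields.BalabanUV.T4Continuum.Support.DirichletScalarTowerLevels

/-!
# `BalabanUV.T4Continuum.Support.DirichletBlockRegTowerRate` — NE2 (node U1a) formalisation swarm, sub-row `T4-U1a.S-NE2-D1-DIRICHLET°`, supplier item
# «Δ1-SKELETON» (file 23, THE END OF THE LINEAGE): A GEOMETRIC TOWER RATE FOR THE `U = 1` SCALAR DIRICHLET TOWER ON EVERY UNION OF UNIT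
# BLOCKS (`d = 3`).  At level `k` (`N = n_k = L^k`, fine lattice `L·N`) the dyadic budget of file 21 with `J = ⌊log_64 N⌋` (large levels) or
# the trivial budget `4n²γ′⁻¹` (the finitely many levels `N < 64`) feeds file 19's defect bound, giving
# `‖(D′)⁻¹J − J D⁻¹‖ ≤ C₁·θ̃^k`, `θ̃ = max(L^{-1/4}, θ_3^{(log_64 L)/2}) ∈ [L⁻¹, 1)`, hence — through the owner's level adapter
# `towerLimitRate_dirichletScalar_of_blockReg_rate` — `TowerLimitRate` with rate `θ̃` for the Ω-compressed scalar tower of EVERY block set `S`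
# (unit b2b-balaban-t4-ne2-formalise-leaf-08, gen 7, file 23)

HONEST FRAMING.  Rung (B)+1 result at MODEL level (U = 1 scalar `Δ′ = Δ + a′Π′`, finite torus, `d = 3`, every union of unit blocks); [folklore];
NE2 (U1a) is NOT proved by this file (U1a is the covariant `d = 4` statement; this is its scalar `d = 3` block-region shadow); spine PROVED 0/9
unchanged; NOT `d = 4` (mixed codimension-3 EDGES need the tube decay), NOT infinite volume, NOT the mass gap, NOT Clay.  HONEST DEPENDENCY
(verbatim): «continuum YM on T⁴ ⇐ BetaPertH ∧ nine spine estimates (0/9 proved); BetaPertH ⇐ (D1) ∧ (D4) ∧ CAP+tail; G-an2-4 gates asym, D1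
and NE2/3/4.»

WHAT THIS FILE PROVES (0 sorry; files 19, 21, 22 and the owner's `towerLimitRate_dirichletScalar_of_blockReg_rate` BY NAME).  Data `thetaT`, `C1`;
`thetaT_lt_one`, `inv_le_thetaT`, `nsq_sdiffH_sdiff_solExt_le_trivial`, `large_level`, **`norm_defect_blockReg_le_rate`**, and the END
**`towerLimitRate_dirichletScalar_blockReg`**.

ABSOLUTE RULE (cell, verbatim): «No internally-minted statement may enter as a cited fact. Every hypothesis is either kernel-proved in
this package or a verbatim quotation of a PUBLISHED theorem with page reference. The manuscript(s) under audit are NOT citable for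
their own disputed steps — they are the thing under adjudication; programme-internal (2001/route/tribunal) claims are never citable.»
[folklore]; two data definitions (constants); no `def … : Prop` fact; no hypothesis beyond `d = 3`, `2 ≤ L`, `0 < a′`.  NOT CLAIMED: `d = 4`, NE2, NE3.
-/

noncomputable section

open scoped BigOperators ComplexConjugate Matrix Matrix.Norms.L2Operator
open Finset

namespace Summit.QuantumFields.BalabanUV.T4Continuum.DirichletBlockRegTowerRate

open Literature.MathematicalPhysics.QuantumFieldTheory.Balaban1983to89.B5Prop11Plancherel (Tor fine)
open Literature.MathematicalPhysics.QuantumFieldTheory.Balaban1983to89.B5Action121 (sdiff)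
open Literature.MathematicalPhysics.QuantumFieldTheory.Balaban1983to89.B5Prop11Lower (nsq nsq_nonneg)
open Literature.MathematicalPhysics.QuantumFieldTheory.Balaban1983to89.B5G183RateUnitTower (lev lev_neZero)
open Summit.QuantumFields.BalabanUV.T4Continuum
open Summit.QuantumFields.BalabanUV.T4Continuum.CovariantAveragingTower (TowerLimitRate)
open Summit.QuantumFields.BalabanUV.T4Continuum.BalabanAveragedTowerUnit (one_le_lev' cast_lev')
open Summit.QuantumFields.BalabanUV.T4Continuum.BackgroundResolventTower
open Summit.QuantumFields.BalabanUV.T4Continuum.ScalarAveragedPropagator (gammaPs gammaPs_pos dirichlet)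
open Summit.QuantumFields.BalabanUV.T4Continuum.DirichletScalarTower
open Summit.QuantumFields.BalabanUV.T4Continuum.DirichletScalarTowerLevels (towerLimitRate_dirichletScalar_of_blockReg_rate)
open Summit.QuantumFields.BalabanUV.T4Continuum.DirichletHoleFilling (theta theta_lt_one)
open Summit.QuantumFields.BalabanUV.T4Continuum.DirichletDirectionalBesovCutoff (energy)
open Summit.QuantumFields.BalabanUV.T4Continuum.DirichletCutoutNearLocal (nsq_sdiffH_sdiff_le_energy)
open Summit.QuantumFields.BalabanUV.T4Continuum.DirichletCutoutBudgetConstants (Kfar Kfar_nonneg)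
open Summit.QuantumFields.BalabanUV.T4Continuum.DirichletCutoutBudgetScale (Knear Knear_nonneg nsq_sdiffH_sdiff_solExt_le_dyadic)
open Summit.QuantumFields.BalabanUV.T4Continuum.DirichletBlockRegDefect (opNorm_defect_blockReg_le_of_budget)
open Summit.QuantumFields.BalabanUV.T4Continuum.DirichletBlockRegRateLemmas
open Summit.QuantumFields.BalabanUV.Beta.GAN24.DirichletBoxCompression (DOm JOm refineR solExt dirichlet_solExt_le)
open Summit.QuantumFields.BalabanUV.Beta.GAN24.DirichletBoxTrace (blockReg)

variable {d : ℕ} (L : ℕ) [NeZero L] (M : Fin d → ℕ) [hM : ∀ μ, NeZero (M μ)] (a' : ℝ) (S : Tor M → Prop) [DecidablePred S]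

/-- the tower rate `θ̃ = max(r₁, r₂)`. [folklore] -/
def thetaT (d L : ℕ) : ℝ := max (r1 L) (r2 (theta d) L)

/-- the tower constant `C₁ = 2d√γ′⁻¹·(√(Kfar·2^19·L) + √Knear·L·(√θ)⁻¹) + 12dγ′⁻¹L`. [folklore] -/
def C1 (d : ℕ) (a' : ℝ) (L : ℕ) : ℝ :=
  2 * d * Real.sqrt ((gammaPs d a')⁻¹) * (Real.sqrt (Kfar d a' * 2 ^ 19 * L) + Real.sqrt (Knear d a') * L * (Real.sqrt (theta d))⁻¹)
    + 12 * d * (gammaPs d a')⁻¹ * L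

omit [NeZero L] in
/-- `θ̃ < 1` (`L ≥ 2`). [folklore] -/
theorem thetaT_lt_one (hL : 2 ≤ L) : thetaT d L < 1 :=
  max_lt (r1_lt_one hL) (r2_lt_one (by linarith [(theta_lt_one d).1]) (theta_lt_one d).2 hL)

omit [NeZero L] in
/-- `L⁻¹ ≤ θ̃` (`L ≥ 1`). [folklore] -/
theorem inv_le_thetaT (hL : 1 ≤ L) : ((L : ℝ))⁻¹ ≤ thetaT d L := (inv_le_r1 hL).trans (le_max_left _ _)

/-- **the trivial budget**: `‖∂_μᴴ∂_μ u_f‖² ≤ 4n²γ′⁻¹‖f‖²` for every region. [folklore] -/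
theorem nsq_sdiffH_sdiff_solExt_le_trivial {n : ℕ} [NeZero n] (ha' : 0 < a') (Ω : Tor (fine n M) → Prop) [DecidablePred Ω] (μ : Fin d)
    (f : {x // Ω x} → ℂ) :
    nsq ((sdiff (fine n M) (n : ℂ) μ)ᴴ *ᵥ (sdiff (fine n M) (n : ℂ) μ *ᵥ solExt n M a' Ω f)) ≤ 4 * (n : ℝ) ^ 2 * (gammaPs d a')⁻¹ * nsq f := by
  have h := nsq_sdiffH_sdiff_le_energy (fine n M) (n : ℂ) μ (solExt n M a' Ω f)
  rw [Complex.norm_natCast] at h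
  have he : energy (fine n M) (n : ℂ) (solExt n M a' Ω f) = dirichlet n M (solExt n M a' Ω f) := rfl
  rw [he] at h
  have hd := dirichlet_solExt_le n M a' Ω ha' f
  nlinarith [hd, sq_nonneg (n : ℝ)]

/-- **large levels** (`2^{J+6} ≤ L·N`, `J = ⌊log_64 N⌋`): the dyadic budget of file 21 through file 19's defect bound gives
`‖(D′)⁻¹J − J D⁻¹‖ ≤ 2d√γ′⁻¹·(√(Kfar·2^19·L)·r₁^k + √Knear·L·(√θ)⁻¹·r₂^k)`. [folklore] -/
theorem large_level (hd : d = 3) (ha' : 0 < a') (k : ℕ) (hbig : 2 ^ (Nat.log 64 (lev L k) + 6) ≤ L * lev L k) :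
    ‖(DOm (L * lev L k) M a' (refineR (lev L k) L M (blockReg (lev L k) M S)))⁻¹ * JOm (lev L k) L M (blockReg (lev L k) M S)
        - JOm (lev L k) L M (blockReg (lev L k) M S) * (DOm (lev L k) M a' (blockReg (lev L k) M S))⁻¹‖
      ≤ 2 * d * Real.sqrt ((gammaPs d a')⁻¹)
        * (Real.sqrt (Kfar d a' * 2 ^ 19 * L) * r1 L ^ k + Real.sqrt (Knear d a') * L * (Real.sqrt (theta d))⁻¹ * r2 (theta d) L ^ k) := by
  -- `√(a + b) ≤ √a + √b` (inlined; the tree holds several copies under unrelated namespaces)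
  have sqrt_add_le' : ∀ {a b : ℝ}, 0 ≤ a → 0 ≤ b → Real.sqrt (a + b) ≤ Real.sqrt a + Real.sqrt b := fun {a b} ha hb => by
    rw [Real.sqrt_le_left (by positivity)]
    have := Real.sq_sqrt ha; have := Real.sq_sqrt hb
    nlinarith [Real.sqrt_nonneg a, Real.sqrt_nonneg b]
  have hN1 : 1 ≤ lev L k := one_le_lev' L k
  have hNR : ((lev L k : ℕ) : ℝ) = (L : ℝ) ^ k := cast_lev' L k
  have hL1 : 1 ≤ L := Nat.one_le_iff_ne_zero.mpr (NeZero.ne L)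
  have hNpos : (0 : ℝ) < (lev L k : ℕ) := by exact_mod_cast hN1
  have hθ0 : 0 < theta d := by linarith [(theta_lt_one d).1]
  have hθ1 : theta d < 1 := (theta_lt_one d).2
  have hKf := Kfar_nonneg d a'
  have hKn := Knear_nonneg d a'
  have hpre : 0 ≤ 2 * d * Real.sqrt ((gammaPs d a')⁻¹) := by positivity
  have hn : ((L * lev L k : ℕ) : ℝ) = (L : ℝ) * (lev L k : ℕ) := by push_cast; ring
  have hLN : (0 : ℝ) < (L : ℝ) * (lev L k : ℕ) := by positivity
  have hQ6 : (2 ^ Nat.log 64 (lev L k)) ^ 6 ≤ lev L k := by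
    rw [← pow_mul, mul_comm, pow_mul]; norm_num
    exact Nat.pow_log_le_self 64 (by omega)
  have hlt : lev L k < 64 ^ (Nat.log 64 (lev L k) + 1) := Nat.lt_pow_succ_log_self (by norm_num) _
  set J := Nat.log 64 (lev L k) with hJdef
  set B : ℝ := Kfar d a' * 2 ^ 19 * ((L * lev L k : ℕ) : ℝ) * ((2 : ℝ) ^ J) ^ 3
    + Knear d a' * (((L * lev L k : ℕ) : ℝ)) ^ 2 * theta d ^ J with hB
  have hB0 : 0 ≤ B := by rw [hB]; positivity
  have hdef := opNorm_defect_blockReg_le_of_budget M a' (lev L k) L hN1 ha' S hB0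
    (fun μ w => nsq_sdiffH_sdiff_solExt_le_dyadic hd ha' S μ hbig w)
  refine hdef.trans ?_
  -- far piece
  have hQN : ((2 : ℝ) ^ J) ^ 6 ≤ (L : ℝ) ^ k := by rw [← hNR]; exact_mod_cast hQ6
  have h1 := sqrt_div_le_r1_pow hL1 (by positivity : (0 : ℝ) ≤ (2 : ℝ) ^ J) hQN
  rw [← hNR] at h1
  have e1 : Real.sqrt (((lev L k : ℕ) : ℝ) * ((2 : ℝ) ^ J) ^ 3) = Real.sqrt (((2 : ℝ) ^ J) ^ 3 / (lev L k : ℕ)) * (lev L k : ℕ) := by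
    rw [← div_eq_iff hNpos.ne',
      show ((2 : ℝ) ^ J) ^ 3 / (lev L k : ℕ) = ((lev L k : ℕ) : ℝ) * ((2 : ℝ) ^ J) ^ 3 / ((lev L k : ℕ) : ℝ) ^ 2 by field_simp,
      Real.sqrt_div' _ (sq_nonneg _), Real.sqrt_sq hNpos.le]
  have hb1 : Real.sqrt (Kfar d a' * 2 ^ 19 * ((L * lev L k : ℕ) : ℝ) * ((2 : ℝ) ^ J) ^ 3)
      ≤ Real.sqrt (Kfar d a' * 2 ^ 19 * L) * r1 L ^ k * (lev L k : ℕ) := by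
    rw [hn, show Kfar d a' * 2 ^ 19 * ((L : ℝ) * (lev L k : ℕ)) * ((2 : ℝ) ^ J) ^ 3
        = (Kfar d a' * 2 ^ 19 * L) * (((lev L k : ℕ) : ℝ) * ((2 : ℝ) ^ J) ^ 3) by ring,
      Real.sqrt_mul (by positivity), e1]
    calc Real.sqrt (Kfar d a' * 2 ^ 19 * L) * (Real.sqrt (((2 : ℝ) ^ J) ^ 3 / (lev L k : ℕ)) * (lev L k : ℕ))
        ≤ Real.sqrt (Kfar d a' * 2 ^ 19 * L) * (r1 L ^ k * (lev L k : ℕ)) :=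
          mul_le_mul_of_nonneg_left (mul_le_mul_of_nonneg_right h1 hNpos.le) (Real.sqrt_nonneg _)
      _ = _ := by ring
  -- near piece
  have hJr : (L : ℝ) ^ k < (64 : ℝ) ^ (J + 1) := by rw [← hNR]; exact_mod_cast hlt
  have h2 := pow_log_le_r2 hθ0 hθ1.le hL1 hJr (k := k)
  have hsθ : Real.sqrt (theta d ^ J) ≤ (Real.sqrt (theta d))⁻¹ * r2 (theta d) L ^ k := by
    have := Real.sqrt_le_sqrt h2
    rw [Real.sqrt_mul (inv_nonneg.mpr hθ0.le), Real.sqrt_inv,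
      show (r2 (theta d) L ^ 2) ^ k = (r2 (theta d) L ^ k) ^ 2 by ring, Real.sqrt_sq (pow_nonneg (r2_nonneg _ L) k)] at this
    exact this
  have hb2 : Real.sqrt (Knear d a' * (((L * lev L k : ℕ) : ℝ)) ^ 2 * theta d ^ J)
      ≤ Real.sqrt (Knear d a') * L * (Real.sqrt (theta d))⁻¹ * r2 (theta d) L ^ k * (lev L k : ℕ) := by
    rw [hn, Real.sqrt_mul (by positivity), Real.sqrt_mul hKn, Real.sqrt_sq hLN.le]
    calc Real.sqrt (Knear d a') * ((L : ℝ) * (lev L k : ℕ)) * Real.sqrt (theta d ^ J)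
        ≤ Real.sqrt (Knear d a') * ((L : ℝ) * (lev L k : ℕ)) * ((Real.sqrt (theta d))⁻¹ * r2 (theta d) L ^ k) :=
          mul_le_mul_of_nonneg_left hsθ (by positivity)
      _ = _ := by ring
  -- assemble
  have hsq : Real.sqrt B ≤ (Real.sqrt (Kfar d a' * 2 ^ 19 * L) * r1 L ^ k
        + Real.sqrt (Knear d a') * L * (Real.sqrt (theta d))⁻¹ * r2 (theta d) L ^ k) * (lev L k : ℕ) := by
    rw [hB]
    refine (sqrt_add_le' (by positivity) (by positivity)).trans ?_
    have := add_le_add hb1 hb2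
    linarith
  have hmain := (div_le_iff₀ hNpos).mpr hsq
  calc 2 * d * Real.sqrt ((gammaPs d a')⁻¹) * Real.sqrt B / (lev L k : ℕ)
      = 2 * d * Real.sqrt ((gammaPs d a')⁻¹) * (Real.sqrt B / (lev L k : ℕ)) := by ring
    _ ≤ _ := mul_le_mul_of_nonneg_left hmain hpre

/-- **THE TWO-LEVEL DEFECT AT EVERY LEVEL (`d = 3`)**: `‖(D′)⁻¹J − J D⁻¹‖ ≤ C₁·θ̃^k` at level `k` of the `L`-adic tower, for every block set `S`.
[folklore] -/
theorem norm_defect_blockReg_le_rate (hd : d = 3) (hL : 2 ≤ L) (ha' : 0 < a') (k : ℕ) :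
    ‖(DOm (L * lev L k) M a' (refineR (lev L k) L M (blockReg (lev L k) M S)))⁻¹ * JOm (lev L k) L M (blockReg (lev L k) M S)
        - JOm (lev L k) L M (blockReg (lev L k) M S) * (DOm (lev L k) M a' (blockReg (lev L k) M S))⁻¹‖
      ≤ C1 d a' L * thetaT d L ^ k := by
  have hN1 : 1 ≤ lev L k := one_le_lev' L k
  have hNR : ((lev L k : ℕ) : ℝ) = (L : ℝ) ^ k := cast_lev' L k
  have hL1 : 1 ≤ L := le_trans one_le_two hL
  have hNpos : (0 : ℝ) < (lev L k : ℕ) := by exact_mod_cast hN1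
  have hγ := (gammaPs_pos (d := d) (a' := a')).1
  have hθ0 : 0 < theta d := by linarith [(theta_lt_one d).1]
  have hθ1 : theta d < 1 := (theta_lt_one d).2
  -- the dyadic exponent `J = ⌊log_64 N⌋`
  have hQ6 : (2 ^ Nat.log 64 (lev L k)) ^ 6 ≤ lev L k := by
    rw [← pow_mul, mul_comm, pow_mul]; norm_num
    exact Nat.pow_log_le_self 64 (by omega)
  have hlt : lev L k < 64 ^ (Nat.log 64 (lev L k) + 1) := Nat.lt_pow_succ_log_self (by norm_num) _
  -- the two ratios against `θ̃`
  have hT0 : 0 ≤ thetaT d L := (r1_nonneg L).trans (le_max_left _ _)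
  have hr1T : r1 L ^ k ≤ thetaT d L ^ k := pow_le_pow_left₀ (r1_nonneg L) (le_max_left _ _) k
  have hr2T : r2 (theta d) L ^ k ≤ thetaT d L ^ k := pow_le_pow_left₀ (r2_nonneg _ L) (le_max_right _ _) k
  have hTk : 0 ≤ thetaT d L ^ k := pow_nonneg hT0 k
  -- the pieces of `C₁`
  have hKf := Kfar_nonneg d a'
  have hKn := Knear_nonneg d a'
  have hX10 : 0 ≤ Real.sqrt (Kfar d a' * 2 ^ 19 * L) := Real.sqrt_nonneg _
  have hX20 : 0 ≤ Real.sqrt (Knear d a') * L * (Real.sqrt (theta d))⁻¹ := by positivity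
  have hC2 : 0 ≤ 12 * d * (gammaPs d a')⁻¹ * L := by positivity
  have hpre : 0 ≤ 2 * d * Real.sqrt ((gammaPs d a')⁻¹) := by positivity
  have hn : ((L * lev L k : ℕ) : ℝ) = (L : ℝ) * (lev L k : ℕ) := by push_cast; ring
  have hLN : (0 : ℝ) < (L : ℝ) * (lev L k : ℕ) := by positivity
  have hC1 : C1 d a' L * thetaT d L ^ k
      = 2 * d * Real.sqrt ((gammaPs d a')⁻¹) * ((Real.sqrt (Kfar d a' * 2 ^ 19 * L)
          + Real.sqrt (Knear d a') * L * (Real.sqrt (theta d))⁻¹) * thetaT d L ^ k)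
        + 12 * d * (gammaPs d a')⁻¹ * L * thetaT d L ^ k := by
    unfold C1; ring
  by_cases hbig : 2 ^ (Nat.log 64 (lev L k) + 6) ≤ L * lev L k
  · exact (large_level L M a' S hd ha' k hbig).trans (by
      rw [hC1]
      have h0 := mul_nonneg hC2 hTk
      have hm : Real.sqrt (Kfar d a' * 2 ^ 19 * L) * r1 L ^ k + Real.sqrt (Knear d a') * L * (Real.sqrt (theta d))⁻¹ * r2 (theta d) L ^ k
          ≤ (Real.sqrt (Kfar d a' * 2 ^ 19 * L) + Real.sqrt (Knear d a') * L * (Real.sqrt (theta d))⁻¹) * thetaT d L ^ k := by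
        calc _ ≤ Real.sqrt (Kfar d a' * 2 ^ 19 * L) * thetaT d L ^ k
              + Real.sqrt (Knear d a') * L * (Real.sqrt (theta d))⁻¹ * thetaT d L ^ k :=
              add_le_add (mul_le_mul_of_nonneg_left hr1T hX10) (mul_le_mul_of_nonneg_left hr2T hX20)
          _ = _ := by ring
      have := mul_le_mul_of_nonneg_left hm hpre
      linarith)
  · -- small levels (`N < 64`): the trivial budget
    have hsmall : L * lev L k < 64 * 2 ^ Nat.log 64 (lev L k) := by
      rw [not_le] at hbig
      have : 2 ^ (Nat.log 64 (lev L k) + 6) = 64 * 2 ^ Nat.log 64 (lev L k) := by rw [pow_add]; ring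
      omega
    have hN64 : lev L k < 64 := lt_64_of_small hL hQ6 hsmall
    have hN64R : (L : ℝ) ^ k < 64 := by rw [← hNR]; exact_mod_cast hN64
    have h3 := third_le_r1_pow hL1 hN64R
    have hBT : 0 ≤ 4 * (((L * lev L k : ℕ) : ℝ)) ^ 2 * (gammaPs d a')⁻¹ := by positivity
    have hdef := opNorm_defect_blockReg_le_of_budget M a' (lev L k) L hN1 ha' S hBT
      (fun μ w => nsq_sdiffH_sdiff_solExt_le_trivial M a' ha' (blockReg (L * lev L k) M S) μ w)
    refine hdef.trans ?_
    have hsq : Real.sqrt (4 * (((L * lev L k : ℕ) : ℝ)) ^ 2 * (gammaPs d a')⁻¹)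
        = 2 * ((L : ℝ) * (lev L k : ℕ)) * Real.sqrt ((gammaPs d a')⁻¹) := by
      rw [hn, Real.sqrt_mul (by positivity), show (4 : ℝ) * ((L : ℝ) * (lev L k : ℕ)) ^ 2 = (2 * ((L : ℝ) * (lev L k : ℕ))) ^ 2 by ring,
        Real.sqrt_sq (by positivity)]
    rw [hsq, hC1]
    set s := Real.sqrt ((gammaPs d a')⁻¹) with hs
    have hγγ : s * s = (gammaPs d a')⁻¹ := Real.mul_self_sqrt (inv_nonneg.mpr hγ.le)
    have e : 2 * d * s * (2 * ((L : ℝ) * (lev L k : ℕ)) * s) / (lev L k : ℕ) = 4 * d * (gammaPs d a')⁻¹ * L := by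
      rw [div_eq_iff hNpos.ne', ← hγγ]; ring
    rw [e]
    have h13 : (1 : ℝ) / 3 ≤ thetaT d L ^ k := h3.trans hr1T
    have h4 : 0 ≤ 4 * d * (gammaPs d a')⁻¹ * L := by positivity
    have h5 : 4 * d * (gammaPs d a')⁻¹ * L ≤ 12 * d * (gammaPs d a')⁻¹ * L * thetaT d L ^ k := by
      have := mul_le_mul_of_nonneg_left h13 h4
      linarith
    have h6 : 0 ≤ 2 * d * s * ((Real.sqrt (Kfar d a' * 2 ^ 19 * L)
          + Real.sqrt (Knear d a') * L * (Real.sqrt (theta d))⁻¹) * thetaT d L ^ k) :=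
      mul_nonneg hpre (mul_nonneg (add_nonneg hX10 hX20) hTk)
    linarith

/-- **THE END OF THE LINEAGE: A GEOMETRIC RATE FOR THE SCALAR DIRICHLET TOWER ON EVERY UNION OF UNIT BLOCKS (`d = 3`).**  `L ≥ 2`, `a′ > 0`,
`S` ANY set of unit blocks of the torus `Tor M`: the `Ω`-compressed `U = 1` scalar tower over `blockReg S` satisfies the owner's
`TowerLimitRate` with rate `θ̃ = max(L^{-1/4}, θ_3^{(log_64 L)/2}) < 1` and constant `Cpert 0 (2d√γ′⁻¹) C₁ 0 0 0`. [folklore] -/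
theorem towerLimitRate_dirichletScalar_blockReg (hd : d = 3) (hL : 2 ≤ L) (ha' : 0 < a') :
    TowerLimitRate (QsR L M (blockReg (lev L 0) M S)) ((L : ℝ) ^ d) (fun k => (DsR L M a' (blockReg (lev L 0) M S) k)⁻¹)
      (Cpert 0 (2 * d * Real.sqrt ((gammaPs d a')⁻¹)) (C1 d a' L) 0 0 0) (thetaT d L) :=
  towerLimitRate_dirichletScalar_of_blockReg_rate L M a' S (by omega) ha' (inv_le_thetaT L (le_trans one_le_two hL)) (thetaT_lt_one L hL)
    fun k => norm_defect_blockReg_le_rate L M a' S hd hL ha' k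

end Summit.QuantumFields.BalabanUV.T4Continuum.DirichletBlockRegTowerRate

end
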